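import Summits.BirchSwinnertonDyer.BirchSwinnertonDyer.Theorems.PrintCf2SplitBadTwoRestrictedSelmerCMSideConditions
import HarnessLib

/-!
# T2⁻ of the stub-critic's STUB-PLAN v1.3 for `stub_heegnerIndexLowerAtTwo` (crux `PrintCf2.SplitBadTwoLowerHalfOfFacts`,
# stmt-BirchSwinnertonDyer-27851): the ONE-SIDED (LOWER) control inequality of road α — TWO values, not four

Scratch certificate of seat `scrit-stub_heegnerIndexLowerAtTwo` g2 (planner, stub-critic; folder `work/`; NOT a proposal —
published as a crux workfile and attached as evidence so that the stub prover or any idle width seat can land it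
`--supports stmt-BirchSwinnertonDyer-27851`). THEOREMS ONLY, no `sorry`, no definitions, no named facts, nothing asserted
about BSD. It is the one-sided reading, for the LOWER child 27851, of the parent's landed control identity
(bricks B5‴ `control_identity_of_pow_mul_natCard` / `hasCharValuationAt_control_identity` (p652120, p652404) and the CM
side conditions `control_identity_endEigenPrimaryTorsion` (p653109), all ns `…Theorems.PrintCf2.RestrictedSelmerPair`):

  parent (S3c₂ of road α v9.1, two-sided):  `n + v_p #𝔖_Γ + v_p #ker = v_p #𝔖_𝔮(K, M) + v_p [𝔖^Γ : res 𝔖_𝔮(K, M)]`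
  child (this file, LOWER):                 `n ≤ v_p #𝔖_𝔮(K, M) + v_p [𝔖^Γ : res 𝔖_𝔮(K, M)]`,
  and, from BOTTOM data only (no `𝔖_Γ`, no Agboola §5, no exact `ker`, no surjectivity of control):
  `Finite 𝔖_𝔮(K, M)` ∧ `[𝔖^Γ : res] ≠ 0` ⟹ `v_p #𝔖^Γ ≤ v_p #𝔖_𝔮(K, M) + v_p [𝔖^Γ : res]` and, for a finitely generated
  torsion dual datum with principal characteristic ideal `(H)`, `ord_p H(0) ≤ v_p #𝔖_𝔮(K, M) + v_p [𝔖^Γ : res]`.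

So the LOWER child's algebraic input on road α is reduced, kernel-checked, to TWO values: an UPPER bound for the bottom
restricted Selmer group `#𝔖_{v̄}(K₀, W*)` (the `≤` half of Agboola §6 / Prop. 8.1 at the additive prime 2) and an UPPER bound
for the control cokernel `[𝔖^Γ : res]` (local restriction kernels: the additive `v̄`-fibre = width brick B7, and the Tamagawa
fibres at `7`, `d`). References: R. Greenberg, LNM 1716 (1999) §3 Lemmas 3.1–3.2, §4 Lemma 4.2 [GreenbergLNM1716];
A. Agboola, Compositio 143 (2007) §3 Prop. 3.2, §5–§6, Prop. 8.1 [Agboola2007]; K. Rubin, LNM 1716 (1999) §2 [Rubin1999].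
-/

noncomputable section

open scoped Classical

set_option linter.dupNamespace false
set_option autoImplicit false

open NumberField IsDedekindDomain Field WeierstrassCurve
open Literature.NumberTheory.EllipticCurves Literature.NumberTheory.EllipticCurves.GreenbergSelmer
open Literature.NumberTheory.EllipticCurves.Agboola2007
open Literature.NumberTheory.EllipticCurves.IwasawaAlgebra
open Literature.NumberTheory.EllipticCurves.IwasawaDual
open Literature.NumberTheory.EllipticCurves.ResKernel
open Literature.NumberTheory.GaloisRepresentations
open Summit.BirchSwinnertonDyer.BirchSwinnertonDyer.Theorems.PrintCf2.RestrictedSelmerPair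

universe u

namespace Summit.BirchSwinnertonDyer.BirchSwinnertonDyer.Theorems.PrintCf2.LowerStubControl

section Generic

variable {K : Type u} [Field K] [NumberField K] {p : ℕ} [Fact p.Prime] (κ : ZpExtension K p)
  (M : Type u) [AddCommGroup M] [DistribMulAction (absoluteGaloisGroup K) M]
  [TopologicalSpace M] [DiscreteTopology M] (𝔮 : HeightOneSpectrum (𝓞 K)) (γ : absoluteGaloisGroup K)

/-- **One-sided control from the bottom (generic `M`).** If the bottom restricted Selmer group `𝔖_𝔮(K, M)` is finite and the
control cokernel index `[𝔖^Γ : res 𝔖_𝔮(K, M)]` is non-zero (i.e. the cokernel is finite), then `𝔖^Γ` is finite (landed: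
`finite_endInvariants_of_finite_restrictedSelmerBase`) and
`v_p #𝔖^Γ ≤ v_p #𝔖_𝔮(K, M) + v_p [𝔖^Γ : res 𝔖_𝔮(K, M)]` — the kernel of control only helps and is dropped.
[cite: Agboola2007, §3 Prop. 3.2] [cite: GreenbergLNM1716, §3 Lemmas 3.1–3.2] -/
theorem padicValNat_card_endInvariants_le (hB : Finite (restrictedSelmerBase M p 𝔮))
    (hidx : (((restrictedSelmerBase M p 𝔮).map (resOfLe M (le_top : κ.kerSubgroup ≤ ⊤))).addSubgroupOf
        (restrictedSelmerZp κ M 𝔮)).relIndex (endInvariants (conjRestricted κ M 𝔮 γ - 1)) ≠ 0) :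
    padicValNat p (Nat.card (endInvariants (conjRestricted κ M 𝔮 γ - 1))) ≤
      padicValNat p (Nat.card (restrictedSelmerBase M p 𝔮)) +
        padicValNat p ((((restrictedSelmerBase M p 𝔮).map (resOfLe M (le_top : κ.kerSubgroup ≤ ⊤))).addSubgroupOf
          (restrictedSelmerZp κ M 𝔮)).relIndex (endInvariants (conjRestricted κ M 𝔮 γ - 1))) := by
  haveI := hB
  have hB0 : Nat.card (restrictedSelmerBase M p 𝔮) ≠ 0 := Nat.card_pos.ne'
  have h2 := card_restrictedSelmerBase_eq_card_ker_mul_card_image κ M 𝔮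
  have h3 := card_endInvariants_eq_card_image_mul_relIndex κ M 𝔮 γ
  have hki : Nat.card ↥(restrictedSelmerBase M p 𝔮 ⊓ (resOfLe M (le_top : κ.kerSubgroup ≤ ⊤)).ker) *
      Nat.card (((restrictedSelmerBase M p 𝔮).map (resOfLe M (le_top : κ.kerSubgroup ≤ ⊤))).addSubgroupOf
        (restrictedSelmerZp κ M 𝔮)) ≠ 0 := by
    rw [← h2]; exact hB0
  have hk := left_ne_zero_of_mul hki
  have hi := right_ne_zero_of_mul hki
  have e2 := congrArg (padicValNat p) h2
  have e3 := congrArg (padicValNat p) h3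
  rw [padicValNat.mul hk hi] at e2
  rw [padicValNat.mul hi hidx] at e3
  omega

/-- **LOWER half of S3c₂ in its own currency (generic `M`, B5′ side conditions displayed).** With the two clauses of road α
v9.1's `stub_restrictedEulerCharBottom_two` — `𝔖^Γ` finite and `p^n · #𝔖_Γ = u · #𝔖^Γ` — the landed four-index identity gives at
once `n ≤ v_p #𝔖_𝔮(K, M) + v_p [𝔖^Γ : res 𝔖_𝔮(K, M)]`: the two left-hand correction terms `v_p #𝔖_Γ` (Agboola §5) and `v_p #ker`
are non-negative and DROPPED — they are the parent's business, not the LOWER child's.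
[cite: Agboola2007, §5, §6, Prop. 8.1] [cite: GreenbergLNM1716, §3–§4] -/
theorem charExp_le_of_pow_mul_natCard (hγ : κ.IsTopGenerator γ)
    (hcont : ∀ m : M, Continuous fun g : absoluteGaloisGroup K ↦ g • m)
    [Finite (FixedPoints.addSubgroup κ.kerSubgroup M ⧸ (subOne κ.kerSubgroup M γ).range)]
    [Finite (endInvariants (conjRestricted κ M 𝔮 γ - 1))] {n : ℕ} {u : ℤ_[p]ˣ}
    (hu : (p : ℤ_[p]) ^ n * (Nat.card (EndCoinvariants (conjRestricted κ M 𝔮 γ - 1)) : ℤ_[p]) =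
      u * Nat.card (endInvariants (conjRestricted κ M 𝔮 γ - 1))) :
    n ≤ padicValNat p (Nat.card (restrictedSelmerBase M p 𝔮)) +
        padicValNat p ((((restrictedSelmerBase M p 𝔮).map (resOfLe M (le_top : κ.kerSubgroup ≤ ⊤))).addSubgroupOf
          (restrictedSelmerZp κ M 𝔮)).relIndex (endInvariants (conjRestricted κ M 𝔮 γ - 1))) := by
  obtain ⟨-, -, -, h⟩ := control_identity_of_pow_mul_natCard κ M 𝔮 γ hγ hcont hu
  omega

end Generic

section CMSummand

variable {K : Type u} [Field K] (V : WeierstrassCurve K) (p : ℕ) [Fact p.Prime] (π : V.endRing) (r : ℤ_[p])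
  [NumberField K] [V.IsElliptic] (κ : ZpExtension K p) {γ : absoluteGaloisGroup K}

/-- **LOWER half of S3c₂ on the CM summand `M = E[𝔮^∞] = ↥(V.endEigenPrimaryTorsion p π r)`, NO side condition** (road α:
`V = W.baseChange K₀`, `p = 2`, `κ = κ*`, `𝔮 = v̄`, `M = W* = W[v̄^∞]`): S3c₂'s two clauses ⟹ `n ≤ v₂ #𝔖_{v̄}(K₀, W*) + v₂ [𝔖^Γ : res]`.
[cite: Agboola2007, §5, §6, Prop. 8.1] [cite: GreenbergLNM1716, §3–§4] [cite: Rubin1999, §2] -/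
theorem charExp_le_of_pow_mul_natCard_endEigenPrimaryTorsion (hγ : κ.IsTopGenerator γ) (𝔮 : HeightOneSpectrum (𝓞 K))
    [Finite (endInvariants (conjRestricted κ ↥(V.endEigenPrimaryTorsion p π r) 𝔮 γ - 1))] {n : ℕ} {u : ℤ_[p]ˣ}
    (hu : (p : ℤ_[p]) ^ n *
        (Nat.card (EndCoinvariants (conjRestricted κ ↥(V.endEigenPrimaryTorsion p π r) 𝔮 γ - 1)) : ℤ_[p]) =
      u * Nat.card (endInvariants (conjRestricted κ ↥(V.endEigenPrimaryTorsion p π r) 𝔮 γ - 1))) :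
    n ≤ padicValNat p (Nat.card (restrictedSelmerBase ↥(V.endEigenPrimaryTorsion p π r) p 𝔮)) +
        padicValNat p ((((restrictedSelmerBase ↥(V.endEigenPrimaryTorsion p π r) p 𝔮).map
            (resOfLe ↥(V.endEigenPrimaryTorsion p π r) (le_top : κ.kerSubgroup ≤ ⊤))).addSubgroupOf
          (restrictedSelmerZp κ ↥(V.endEigenPrimaryTorsion p π r) 𝔮)).relIndex
          (endInvariants (conjRestricted κ ↥(V.endEigenPrimaryTorsion p π r) 𝔮 γ - 1))) := by
  obtain ⟨-, -, -, h⟩ := control_identity_endEigenPrimaryTorsion V p π r κ hγ 𝔮 hu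
  omega

/-- **LOWER half in dual-datum currency (v9 S3c / S3b′), CM summand, NO side condition**: `D.HasCharValuationAt n`
(`X` torsion, `Ch_Λ = (H)`, `H(0) ≠ 0`, `ord_p H(0) = n`) ⟹ `n ≤ v_p #𝔖_𝔮(K, M) + v_p [𝔖^Γ : res]`.
[cite: Agboola2007, §5, Thm. 2] [cite: GreenbergLNM1716, §4 Lemma 4.2] -/
theorem charExp_le_of_hasCharValuationAt_endEigenPrimaryTorsion (hγ : κ.IsTopGenerator γ)
    (𝔮 : HeightOneSpectrum (𝓞 K)) (D : RestrictedDualData κ ↥(V.endEigenPrimaryTorsion p π r) 𝔮 γ)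
    [Module.Finite (IwasawaAlgebra p) D.X] {n : ℕ} (h : D.HasCharValuationAt n) :
    n ≤ padicValNat p (Nat.card (restrictedSelmerBase ↥(V.endEigenPrimaryTorsion p π r) p 𝔮)) +
        padicValNat p ((((restrictedSelmerBase ↥(V.endEigenPrimaryTorsion p π r) p 𝔮).map
            (resOfLe ↥(V.endEigenPrimaryTorsion p π r) (le_top : κ.kerSubgroup ≤ ⊤))).addSubgroupOf
          (restrictedSelmerZp κ ↥(V.endEigenPrimaryTorsion p π r) 𝔮)).relIndex
          (endInvariants (conjRestricted κ ↥(V.endEigenPrimaryTorsion p π r) 𝔮 γ - 1))) := by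
  obtain ⟨-, -, -, -, h'⟩ := hasCharValuationAt_control_identity_endEigenPrimaryTorsion V p π r κ hγ 𝔮 D h
  omega

/-- **The LOWER child's T2⁻ from BOTTOM data only (CM summand).** For a finitely generated TORSION dual datum with a
principal characteristic ideal `(H)` — which is what the CONTAINMENT half of the main conjecture hands over — finiteness of
the bottom group `𝔖_𝔮(K, M)` and of the control cokernel ALONE give `𝔖^Γ` finite (hence `H(0) ≠ 0`, Greenberg's Lemma 4.2,
landed as `hasCharValuationAt_of_finite_endInvariants`) and **`ord_p H(0) ≤ v_p #𝔖_𝔮(K, M) + v_p [𝔖^Γ : res 𝔖_𝔮(K, M)]`**.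
Road α, LOWER child: `ord₂ H(0) ≤ v₂ #𝔖_{v̄}(K₀, W*) + v₂ [𝔖^Γ : res]` — no `H¹(Γ, 𝔖)`, no exact kernel, no surjectivity.
[cite: GreenbergLNM1716, §4 Lemma 4.2 (p. 102)] [cite: Agboola2007, §3 Prop. 3.2, §5–§6, Prop. 8.1] -/
theorem valuation_constantCoeff_le_of_finite_bottom (hγ : κ.IsTopGenerator γ) (𝔮 : HeightOneSpectrum (𝓞 K))
    (D : RestrictedDualData κ ↥(V.endEigenPrimaryTorsion p π r) 𝔮 γ) [Module.Finite (IwasawaAlgebra p) D.X]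
    (hX : Module.IsTorsion (IwasawaAlgebra p) D.X) (H : IwasawaAlgebra p) (hH : D.charIdeal = Ideal.span {H})
    (hB : Finite (restrictedSelmerBase ↥(V.endEigenPrimaryTorsion p π r) p 𝔮))
    (hidx : (((restrictedSelmerBase ↥(V.endEigenPrimaryTorsion p π r) p 𝔮).map
            (resOfLe ↥(V.endEigenPrimaryTorsion p π r) (le_top : κ.kerSubgroup ≤ ⊤))).addSubgroupOf
          (restrictedSelmerZp κ ↥(V.endEigenPrimaryTorsion p π r) 𝔮)).relIndex
          (endInvariants (conjRestricted κ ↥(V.endEigenPrimaryTorsion p π r) 𝔮 γ - 1)) ≠ 0) :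
    PowerSeries.constantCoeff H ≠ 0 ∧
      (PowerSeries.constantCoeff H).valuation ≤
        padicValNat p (Nat.card (restrictedSelmerBase ↥(V.endEigenPrimaryTorsion p π r) p 𝔮)) +
          padicValNat p ((((restrictedSelmerBase ↥(V.endEigenPrimaryTorsion p π r) p 𝔮).map
              (resOfLe ↥(V.endEigenPrimaryTorsion p π r) (le_top : κ.kerSubgroup ≤ ⊤))).addSubgroupOf
            (restrictedSelmerZp κ ↥(V.endEigenPrimaryTorsion p π r) 𝔮)).relIndex
            (endInvariants (conjRestricted κ ↥(V.endEigenPrimaryTorsion p π r) 𝔮 γ - 1))) := by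
  have hfin := finite_endInvariants_of_finite_restrictedSelmerBase κ ↥(V.endEigenPrimaryTorsion p π r) 𝔮 γ hB hidx
  have hD := RestrictedDualData.hasCharValuationAt_of_finite_endInvariants D
    (exists_pow_smul_endEigenPrimaryTorsion_eq_zero V p π r) (isOpen_stabilizer_endEigenPrimaryTorsion V p π r) hγ hX H hH
    hfin
  refine ⟨?_, charExp_le_of_hasCharValuationAt_endEigenPrimaryTorsion V p π r κ hγ 𝔮 D hD⟩
  obtain ⟨-, H', hH', hH'0, -⟩ := hD
  intro h0
  have hval := Castella2018.AcSelmer.valuation_constantCoeff_eq_of_span_singleton_eq (hH'.symm.trans hH) hH'0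
  exact hval.1 h0

end CMSummand

section Chain

/-- **The LOWER chain of road α as pure bookkeeping (B8 made explicit).** Analytic value `m = 2A + e_A` (S2′), main-conjecture
CONTAINMENT `m ≤ 2n + e_M` (the half of S3b′ the LOWER child consumes), one-sided control `n ≤ b + c` (this file), bottom value
`b ≤ B₁ + t` (the `≤` half of Agboola §6 / Prop. 8.1: Ш- and local-index terms) and cokernel bound `c ≤ k` (local kernels)
give `2A ≤ 2(B₁ + t + k) + e_M − e_A`: the right-hand constant is `e_M − e_A + 2(t + k)` — it must be an EXPLICIT table on
the dyadic class of `d`; with `∃`-bound corrections the conclusion is vacuous (battery item B8). Nothing but linear arithmetic. -/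
theorem lower_chain {A B₁ m n b c t k e_A e_M : ℤ}
    (hS2 : m = 2 * A + e_A) (hMC : m ≤ 2 * n + e_M) (hctl : n ≤ b + c) (hbot : b ≤ B₁ + t) (hcok : c ≤ k) :
    2 * A ≤ 2 * (B₁ + t + k) + e_M - e_A := by
  omega

end Chain

end Summit.BirchSwinnertonDyer.BirchSwinnertonDyer.Theorems.PrintCf2.LowerStubControl

end
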